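import Mathlib.NumberTheory.EulerProduct.DirichletLSeries
import Mathlib.NumberTheory.ArithmeticFunction.Misc
import Mathlib.NumberTheory.SumPrimeReciprocals
import Mathlib.Analysis.SpecialFunctions.Complex.LogBounds
import Mathlib.Analysis.Normed.Module.MultipliableUniformlyOn
import Mathlib.Analysis.Complex.LocallyUniformLimit
import Literature.NumberTheory.LFunctions.SatheSelberg
import Literature.NumberTheory.LFunctions.LogZetaClassicalRegion
import Literature.NumberTheory.LFunctions.PartialEulerProductsProofs
import HarnessLib

/-!
# The Euler product of `∑ z^{ω(n)} n^{-s}` (Montgomery–Vaughan §7.4.1, Exercise 3 (a)–(b))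

Support file for the Sathe–Selberg formula `Literature.NumberTheory.LFunctions.MontgomeryVaughan2007_exercise_7_4_3c`
(`SatheSelberg.lean`). Everything here is PROVED (no named facts).

For complex `z` the multiplicative coefficients `a_z(n) = z^{ω(n)}` have the Dirichlet series
`D(s, z) = ∑ z^{ω(n)} n^{-s} = ∏_p (1 + z p^{-s}/(1 - p^{-s}))` (`σ > 1`), and
`D(s, z) = F(s, z) · exp(z ∑_p -Log(1 - p^{-s}))` with the Euler product
`F(s, z) = ∏_p E_p(s, z)`, `E_p(s, z) = (1 + z p^{-s}/(1 - p^{-s})) exp(z Log(1 - p^{-s}))`,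
absolutely convergent for `σ > 1/2` (MV Exercise 7.4.1.3 (a), (b): "`F(s,z)` converges for
`σ > 1/2` uniformly for `|z| ≤ R`" and "`a_z(n) = z^{ω(n)}`").

## References

* [MontgomeryVaughan2007] H. L. Montgomery, R. C. Vaughan, *Multiplicative Number Theory I*,
  CUP 2007, §7.4.1 Exercise 3.
-/

noncomputable section

open Complex LSeries Filter Topology Finset

namespace Literature.NumberTheory.LFunctions

namespace SatheSelberg

open scoped ArithmeticFunction.omega

/-! ### The coefficients `z^{ω(n)}` -/

/-- The coefficients `a_z(n) = z^{ω(n)}`. [cite: MontgomeryVaughan2007, §7.4.1 Exercise 3(b)] -/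
def omegaCoeff (z : ℂ) (n : ℕ) : ℂ := z ^ (ω n)

/-- `a_z(1) = 1`. [folklore] -/
theorem omegaCoeff_one (z : ℂ) : omegaCoeff z 1 = 1 := by simp [omegaCoeff]

/-- `a_z` is multiplicative. [folklore] -/
theorem omegaCoeff_mul (z : ℂ) {m n : ℕ} (h : m.Coprime n) :
    omegaCoeff z (m * n) = omegaCoeff z m * omegaCoeff z n := by
  simp [omegaCoeff, ArithmeticFunction.cardDistinctFactors_mul h, pow_add]

/-- `a_z(p^k) = z` for `k ≥ 1`. [folklore] -/
theorem omegaCoeff_prime_pow (z : ℂ) {p k : ℕ} (hp : p.Prime) (hk : k ≠ 0) :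
    omegaCoeff z (p ^ k) = z := by
  simp [omegaCoeff, ArithmeticFunction.cardDistinctFactors_apply_prime_pow hp hk]

/-- `‖a_z(n)‖ = ‖z‖^{ω(n)}`. [folklore] -/
theorem norm_omegaCoeff (z : ℂ) (n : ℕ) : ‖omegaCoeff z n‖ = ‖z‖ ^ (ω n) := by
  simp [omegaCoeff, norm_pow]

/-- The terms `f(n) n^{-s}` of the Dirichlet series of a multiplicative `f` are multiplicative.
[folklore] -/
theorem term_mul_of_coprime {f : ℕ → ℂ} (hf : ∀ {m n : ℕ}, m.Coprime n → f (m * n) = f m * f n)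
    (s : ℂ) {m n : ℕ} (h : m.Coprime n) :
    term f s (m * n) = term f s m * term f s n := by
  rcases eq_or_ne m 0 with rfl | hm
  · simp
  rcases eq_or_ne n 0 with rfl | hn
  · simp
  rw [term_of_ne_zero (mul_ne_zero hm hn), term_of_ne_zero hm, term_of_ne_zero hn, hf h,
    Nat.cast_mul, natCast_mul_natCast_cpow, div_mul_div_comm]

/-- The terms at prime powers: `a_z(p^e) (p^e)^{-s} = z (p^{-s})^e` for `e ≥ 1`. [folklore] -/
theorem term_omegaCoeff_prime_pow (z s : ℂ) {p : ℕ} (hp : p.Prime) {e : ℕ} (he : e ≠ 0) :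
    term (omegaCoeff z) s (p ^ e) = z * ((p : ℂ) ^ (-s)) ^ e := by
  have hpe : p ^ e ≠ 0 := pow_ne_zero _ hp.ne_zero
  rw [term_of_ne_zero hpe, omegaCoeff_prime_pow z hp he, Nat.cast_pow, ← cpow_nat_mul,
    ← natCast_cpow_natCast_mul, div_eq_mul_inv, ← cpow_neg, mul_neg]

/-- Norm of the terms at prime powers: `‖z‖ (p^{-σ})^e` for `e ≥ 1`. [folklore] -/
theorem norm_term_omegaCoeff_prime_pow (z s : ℂ) {p : ℕ} (hp : p.Prime) {e : ℕ} (he : e ≠ 0) :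
    ‖term (omegaCoeff z) s (p ^ e)‖ = ‖z‖ * ((p : ℝ) ^ (-s.re)) ^ e := by
  rw [term_omegaCoeff_prime_pow z s hp he, norm_mul, norm_pow,
    norm_natCast_cpow_of_pos hp.pos, neg_re]

/-! ### Absolute convergence for `σ > 1` -/

/-- For a prime `p` and `σ > 0`: `0 ≤ p^{-σ} < 1`, indeed `p^{-σ} ≤ 2^{-σ}`. [folklore] -/
theorem prime_rpow_neg_lt_one {p : ℕ} (hp : p.Prime) {σ : ℝ} (hσ : 0 < σ) :
    (p : ℝ) ^ (-σ) < 1 :=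
  Real.rpow_lt_one_of_one_lt_of_neg (by exact_mod_cast hp.one_lt) (by linarith)

/-- The local factor of `∑ ‖a_z(n) n^{-s}‖` at `p`: summable, with sum
`1 + ‖z‖ p^{-σ}/(1 - p^{-σ})`. [folklore] -/
theorem hasSum_norm_term_omegaCoeff_prime_pow (z s : ℂ) {p : ℕ} (hp : p.Prime) (hs : 0 < s.re) :
    HasSum (fun e : ℕ ↦ ‖term (omegaCoeff z) s (p ^ e)‖)
      (1 + ‖z‖ * ((p : ℝ) ^ (-s.re) / (1 - (p : ℝ) ^ (-s.re)))) := by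
  set q : ℝ := (p : ℝ) ^ (-s.re) with hq
  have hq0 : 0 ≤ q := Real.rpow_nonneg (Nat.cast_nonneg _) _
  have hq1 : q < 1 := prime_rpow_neg_lt_one hp hs
  have hgeom : HasSum (fun e : ℕ ↦ ‖z‖ * q ^ (e + 1)) (‖z‖ * (q / (1 - q))) := by
    have h := (hasSum_geometric_of_lt_one hq0 hq1).mul_left (‖z‖ * q)
    have e1 : (fun e : ℕ ↦ ‖z‖ * q ^ (e + 1)) = fun i ↦ ‖z‖ * q * q ^ i := by
      funext i; ring
    have e2 : ‖z‖ * (q / (1 - q)) = ‖z‖ * q * (1 - q)⁻¹ := by rw [div_eq_mul_inv]; ring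
    rw [e1, e2]; exact h
  have e3 : (fun e : ℕ ↦ ‖term (omegaCoeff z) s (p ^ (e + 1))‖) = fun e ↦ ‖z‖ * q ^ (e + 1) := by
    funext e; rw [norm_term_omegaCoeff_prime_pow z s hp (Nat.succ_ne_zero e)]
  have h0 : ‖term (omegaCoeff z) s (p ^ 0)‖ = 1 := by
    rw [pow_zero, term_of_ne_zero one_ne_zero, omegaCoeff_one, Nat.cast_one, one_cpow, div_one,
      norm_one]
  have h1 : HasSum (fun e : ℕ ↦ ‖term (omegaCoeff z) s (p ^ (e + 1))‖) (‖z‖ * (q / (1 - q))) := by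
    rw [e3]; exact hgeom
  have h2 : HasSum (fun e : ℕ ↦ ‖term (omegaCoeff z) s (p ^ e)‖)
      (‖term (omegaCoeff z) s (p ^ 0)‖ + ‖z‖ * (q / (1 - q))) :=
    HasSum.zero_add (f := fun e : ℕ ↦ ‖term (omegaCoeff z) s (p ^ e)‖) h1
  rwa [h0] at h2

/-- **Absolute convergence of `∑ z^{ω(n)} n^{-s}` for `σ > 1`** (partial sums of the
non-negative multiplicative majorant are bounded by the Euler product
`∏_p (1 + ‖z‖p^{-σ}/(1-p^{-σ})) ≤ exp(2‖z‖ ∑_p p^{-σ})`).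
[cite: MontgomeryVaughan2007, §7.4.1 Exercise 3(b)] -/
theorem summable_norm_term_omegaCoeff (z : ℂ) {s : ℂ} (hs : 1 < s.re) :
    Summable fun n ↦ ‖term (omegaCoeff z) s n‖ := by
  set F : ℕ → ℝ := fun n ↦ ‖term (omegaCoeff z) s n‖ with hF
  have hσ : 0 < s.re := by linarith
  have hF1 : F 1 = 1 := by simp [hF, omegaCoeff_one]
  have hFmul : ∀ {m n : ℕ}, m.Coprime n → F (m * n) = F m * F n := by
    intro m n hmn
    simp only [hF, term_mul_of_coprime (fun h ↦ omegaCoeff_mul z h) s hmn, norm_mul]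
  have hF0 : ∀ n, 0 ≤ F n := fun n ↦ norm_nonneg _
  have hFsum : ∀ {p : ℕ}, p.Prime → Summable (fun e : ℕ ↦ ‖F (p ^ e)‖) := by
    intro p hp
    simp only [hF, norm_norm]
    exact (hasSum_norm_term_omegaCoeff_prime_pow z s hp hσ).summable
  -- the prime sum `S = ∑_p p^{-σ}`
  have hS : Summable fun p : Nat.Primes ↦ ((p : ℕ) : ℝ) ^ (-s.re) :=
    Nat.Primes.summable_rpow.2 (by linarith)
  set S : ℝ := ∑' p : Nat.Primes, ((p : ℕ) : ℝ) ^ (-s.re) with hSdef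
  have hS0 : ∀ p : Nat.Primes, 0 ≤ ((p : ℕ) : ℝ) ^ (-s.re) := fun p ↦
    Real.rpow_nonneg (Nat.cast_nonneg _) _
  -- local factors are `≤ exp(2‖z‖ p^{-σ})`
  have hloc : ∀ {p : ℕ}, p.Prime →
      ∑' e : ℕ, F (p ^ e) ≤ Real.exp (2 * ‖z‖ * (p : ℝ) ^ (-s.re)) := by
    intro p hp
    have h := (hasSum_norm_term_omegaCoeff_prime_pow z s hp hσ).tsum_eq
    simp only [hF]
    rw [h]
    set q : ℝ := (p : ℝ) ^ (-s.re)
    have hq0 : 0 ≤ q := Real.rpow_nonneg (Nat.cast_nonneg _) _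
    have hq2 : q ≤ 1 / 2 := by
      have h2 : (2 : ℝ) ≤ p := by exact_mod_cast hp.two_le
      calc q ≤ (2 : ℝ) ^ (-s.re) :=
            Real.rpow_le_rpow_of_nonpos (by norm_num) h2 (by linarith)
        _ ≤ (2 : ℝ) ^ (-1 : ℝ) :=
            Real.rpow_le_rpow_of_exponent_le (by norm_num) (by linarith)
        _ = 1 / 2 := by norm_num
    have hkey : q / (1 - q) ≤ 2 * q := by
      rw [div_le_iff₀ (by linarith)]
      nlinarith
    calc 1 + ‖z‖ * (q / (1 - q)) ≤ 1 + ‖z‖ * (2 * q) := by gcongr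
      _ = 2 * ‖z‖ * q + 1 := by ring
      _ ≤ Real.exp (2 * ‖z‖ * q) := Real.add_one_le_exp _
  refine summable_of_sum_range_le hF0 (c := Real.exp (2 * ‖z‖ * S)) fun N ↦ ?_
  obtain ⟨-, hhas⟩ :=
    EulerProduct.summable_and_hasSum_smoothNumbers_prod_primesBelow_tsum hF1 hFmul hFsum N
  -- every `0 < n < N` is `N`-smooth
  have h1 : ∑ n ∈ range N, F n = ∑ n ∈ Ico 1 N, F n := by
    rcases Nat.eq_zero_or_pos N with rfl | hN
    · simp
    · rw [Finset.range_eq_Ico, ← Finset.sum_Ico_consecutive _ (Nat.zero_le 1) hN]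
      simp [hF]
  have h2 : ∑ n ∈ Ico 1 N, F n = ∑ m ∈ (Ico 1 N).subtype (· ∈ N.smoothNumbers), F (m : ℕ) := by
    rw [Finset.sum_subtype_eq_sum_filter]
    refine Finset.sum_congr ?_ fun _ _ ↦ rfl
    refine (Finset.filter_true_of_mem fun d hd ↦ ?_).symm
    rw [Finset.mem_Ico] at hd
    exact Nat.mem_smoothNumbers_of_lt hd.1 hd.2
  have h3 : ∑ m ∈ (Ico 1 N).subtype (· ∈ N.smoothNumbers), F (m : ℕ) ≤
      ∏ p ∈ N.primesBelow, ∑' e : ℕ, F (p ^ e) :=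
    sum_le_hasSum _ (fun m _ ↦ hF0 _) hhas
  have h4 : ∏ p ∈ N.primesBelow, ∑' e : ℕ, F (p ^ e) ≤
      ∏ p ∈ N.primesBelow, Real.exp (2 * ‖z‖ * (p : ℝ) ^ (-s.re)) := by
    refine Finset.prod_le_prod (fun p _ ↦ tsum_nonneg fun e ↦ hF0 _) fun p hp ↦ ?_
    exact hloc (Nat.prime_of_mem_primesBelow hp)
  have h5 : ∏ p ∈ N.primesBelow, Real.exp (2 * ‖z‖ * (p : ℝ) ^ (-s.re)) =
      Real.exp (2 * ‖z‖ * ∑ p ∈ N.primesBelow, (p : ℝ) ^ (-s.re)) := by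
    rw [Finset.mul_sum, Real.exp_sum]
  have h6 : ∑ p ∈ N.primesBelow, (p : ℝ) ^ (-s.re) ≤ S := by
    have hprime : ∀ p ∈ N.primesBelow, Nat.Prime p := fun p hp ↦ Nat.prime_of_mem_primesBelow hp
    have e : ∑ p ∈ N.primesBelow, (p : ℝ) ^ (-s.re) =
        ∑ p ∈ (N.primesBelow).subtype Nat.Prime, ((p : ℕ) : ℝ) ^ (-s.re) := by
      conv_lhs => rw [← Finset.filter_true_of_mem hprime, ← Finset.subtype_map,
        Finset.sum_map]
      rfl
    rw [e]
    exact sum_le_hasSum (f := fun p : Nat.Primes ↦ ((p : ℕ) : ℝ) ^ (-s.re)) _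
      (fun p _ ↦ hS0 p) hS.hasSum
  calc ∑ n ∈ range N, F n = ∑ n ∈ Ico 1 N, F n := h1
    _ ≤ ∏ p ∈ N.primesBelow, ∑' e : ℕ, F (p ^ e) := h2 ▸ h3
    _ ≤ Real.exp (2 * ‖z‖ * ∑ p ∈ N.primesBelow, (p : ℝ) ^ (-s.re)) := h5 ▸ h4
    _ ≤ Real.exp (2 * ‖z‖ * S) := by gcongr

/-- `LSeriesSummable` form. [folklore] -/
theorem LSeriesSummable_omegaCoeff (z : ℂ) {s : ℂ} (hs : 1 < s.re) :
    LSeriesSummable (omegaCoeff z) s :=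
  (summable_norm_term_omegaCoeff z hs).of_norm


/-! ### The Euler product of `D(s, z) = ∑ z^{ω(n)} n^{-s}` -/

/-- The local factor at `p`: `∑_e a_z(p^e) p^{-es} = 1 + z p^{-s}/(1 - p^{-s})` (`σ > 0`).
[cite: MontgomeryVaughan2007, §7.4.1 Exercise 3(b)] -/
theorem hasSum_term_omegaCoeff_prime_pow (z : ℂ) {s : ℂ} (hs : 0 < s.re) (p : Nat.Primes) :
    HasSum (fun e : ℕ ↦ term (omegaCoeff z) s ((p : ℕ) ^ e))
      (1 + z * ((p : ℂ) ^ (-s) / (1 - (p : ℂ) ^ (-s)))) := by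
  set q : ℂ := (p : ℂ) ^ (-s) with hq
  have hqn : ‖q‖ < 1 := by
    rw [hq, norm_natCast_cpow_of_pos p.prop.pos, neg_re]
    exact prime_rpow_neg_lt_one p.prop hs
  have hgeom : HasSum (fun e : ℕ ↦ z * q ^ (e + 1)) (z * (q / (1 - q))) := by
    have h := (hasSum_geometric_of_norm_lt_one hqn).mul_left (z * q)
    have e1 : (fun e : ℕ ↦ z * q ^ (e + 1)) = fun i ↦ z * q * q ^ i := by
      funext i; ring
    have e2 : z * (q / (1 - q)) = z * q * (1 - q)⁻¹ := by rw [div_eq_mul_inv]; ring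
    rw [e1, e2]; exact h
  have e3 : (fun e : ℕ ↦ term (omegaCoeff z) s ((p : ℕ) ^ (e + 1))) =
      fun e ↦ z * q ^ (e + 1) := by
    funext e; rw [term_omegaCoeff_prime_pow z s p.prop (Nat.succ_ne_zero e)]
  have h0 : term (omegaCoeff z) s ((p : ℕ) ^ 0) = 1 := by
    rw [pow_zero, term_of_ne_zero one_ne_zero, omegaCoeff_one, Nat.cast_one, one_cpow, div_one]
  have h1 : HasSum (fun e : ℕ ↦ term (omegaCoeff z) s ((p : ℕ) ^ (e + 1)))
      (z * (q / (1 - q))) := by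
    rw [e3]; exact hgeom
  have h2 : HasSum (fun e : ℕ ↦ term (omegaCoeff z) s ((p : ℕ) ^ e))
      (term (omegaCoeff z) s ((p : ℕ) ^ 0) + z * (q / (1 - q))) :=
    HasSum.zero_add (f := fun e : ℕ ↦ term (omegaCoeff z) s ((p : ℕ) ^ e)) h1
  rwa [h0] at h2

/-- **The Euler product** `∑ z^{ω(n)} n^{-s} = ∏_p (1 + z p^{-s}/(1 - p^{-s}))` for `σ > 1`.
[cite: MontgomeryVaughan2007, §7.4.1 Exercise 3(b)] -/
theorem hasProd_LSeries_omegaCoeff (z : ℂ) {s : ℂ} (hs : 1 < s.re) :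
    HasProd (fun p : Nat.Primes ↦ 1 + z * ((p : ℂ) ^ (-s) / (1 - (p : ℂ) ^ (-s))))
      (LSeries (omegaCoeff z) s) := by
  have hsum := summable_norm_term_omegaCoeff z hs
  have h1 : term (omegaCoeff z) s 1 = 1 := by
    rw [term_of_ne_zero one_ne_zero, omegaCoeff_one, Nat.cast_one, one_cpow, div_one]
  have hmul : ∀ {m n : ℕ}, m.Coprime n →
      term (omegaCoeff z) s (m * n) = term (omegaCoeff z) s m * term (omegaCoeff z) s n :=
    fun h ↦ term_mul_of_coprime (fun h' ↦ omegaCoeff_mul z h') s h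
  have hE := EulerProduct.eulerProduct_hasProd h1 hmul hsum (term_zero _ _)
  have heq : (fun p : Nat.Primes ↦ ∑' e : ℕ, term (omegaCoeff z) s ((p : ℕ) ^ e)) =
      fun p : Nat.Primes ↦ 1 + z * ((p : ℂ) ^ (-s) / (1 - (p : ℂ) ^ (-s))) :=
    funext fun p ↦ (hasSum_term_omegaCoeff_prime_pow z (by linarith) p).tsum_eq
  rw [heq] at hE
  exact hE

/-! ### The factors `E_p(s, z)` and the product `F(s, z)` -/

/-- Selberg's Euler factor `E_p(s, z) = (1 + z p^{-s}/(1 - p^{-s})) · exp(z Log(1 - p^{-s}))`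
(so that `E_p(s, z) · (1 - p^{-s})^{-z} = 1 + z p^{-s}/(1 - p^{-s})`, the local factor of
`∑ z^{ω(n)} n^{-s}`). [cite: MontgomeryVaughan2007, §7.4.1 Exercise 3(a)] -/
def eulerFactor (p : ℕ) (s z : ℂ) : ℂ :=
  (1 + z * ((p : ℂ) ^ (-s) / (1 - (p : ℂ) ^ (-s)))) * exp (z * log (1 - (p : ℂ) ^ (-s)))

/-- `F(s, z) = ∏_p E_p(s, z)` (MV's `F(s, z) = ∏_p (1 + z/(p^s - 1))(1 - p^{-s})^z`).
[cite: MontgomeryVaughan2007, §7.4.1 Exercise 3(a)] -/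
def selbergF (s z : ℂ) : ℂ := ∏' p : Nat.Primes, eulerFactor p s z

/-- **The factors are quadratically close to `1`**: for `‖q‖ ≤ 1/2` and `‖z‖ ‖q‖ ≤ 1/4`,
`‖(1 + z q/(1 - q)) exp(z Log(1 - q)) - 1‖ ≤ 10 (‖z‖ + ‖z‖²) ‖q‖²`. [folklore] -/
theorem norm_factor_sub_one_le {q z : ℂ} (hq : ‖q‖ ≤ 1 / 2) (hzq : ‖z‖ * ‖q‖ ≤ 1 / 4) :
    ‖(1 + z * (q / (1 - q))) * exp (z * log (1 - q)) - 1‖ ≤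
      10 * (‖z‖ + ‖z‖ ^ 2) * ‖q‖ ^ 2 := by
  set t : ℝ := ‖q‖ with ht
  set r : ℝ := ‖z‖ with hr
  have ht0 : 0 ≤ t := norm_nonneg _
  have hr0 : 0 ≤ r := norm_nonneg _
  have hrt0 : 0 ≤ r * t := mul_nonneg hr0 ht0
  have hnq : ‖-q‖ < 1 := by rw [norm_neg]; linarith
  have h1q : (1 : ℂ) - q ≠ 0 := by
    intro h
    have : ‖q‖ = 1 := by rw [← sub_eq_zero.1 h]; simp
    linarith
  have h1qn : 1 / 2 ≤ ‖1 - q‖ := by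
    have := norm_sub_norm_le (1 : ℂ) q
    rw [norm_one] at this
    linarith
  -- `ℓ = Log(1 - q) + q`, `‖ℓ‖ ≤ t²`
  set ℓ : ℂ := log (1 - q) + q with hℓdef
  have hℓ : ‖ℓ‖ ≤ t ^ 2 := by
    have h := norm_log_one_add_sub_self_le hnq
    rw [norm_neg, ← sub_eq_add_neg, sub_neg_eq_add] at h
    have h2 : (1 - t)⁻¹ ≤ 2 := by
      rw [inv_le_comm₀ (by linarith) (by norm_num)]; linarith
    calc ‖ℓ‖ ≤ t ^ 2 * (1 - t)⁻¹ / 2 := h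
      _ ≤ t ^ 2 * 2 / 2 := by gcongr
      _ = t ^ 2 := by ring
  -- `w = z Log(1 - q)`, `‖w‖ ≤ 2 r t ≤ 1`
  set w : ℂ := z * log (1 - q) with hwdef
  have hlog : log (1 - q) = ℓ - q := by rw [hℓdef]; ring
  have ht2 : t ^ 2 ≤ t / 2 := by nlinarith
  have hw : ‖w‖ ≤ 2 * r * t := by
    rw [hwdef, hlog, mul_sub]
    calc ‖z * ℓ - z * q‖ ≤ ‖z * ℓ‖ + ‖z * q‖ := norm_sub_le _ _
      _ = r * ‖ℓ‖ + r * t := by rw [norm_mul, norm_mul]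
      _ ≤ r * t ^ 2 + r * t := by gcongr
      _ ≤ r * (t / 2) + r * t := by gcongr
      _ ≤ 2 * r * t := by nlinarith
  have hw1 : ‖w‖ ≤ 1 := by nlinarith
  -- `ε = e^w - 1 - w`, `‖ε‖ ≤ 4 r² t²`
  set ε : ℂ := exp w - 1 - w with hεdef
  have hε : ‖ε‖ ≤ 4 * r ^ 2 * t ^ 2 := by
    calc ‖ε‖ ≤ ‖w‖ ^ 2 := norm_exp_sub_one_sub_id_le hw1
      _ ≤ (2 * r * t) ^ 2 := pow_le_pow_left₀ (norm_nonneg _) hw 2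
      _ = 4 * r ^ 2 * t ^ 2 := by ring
  -- `A = zq`, `B = zq²/(1 - q)`
  set A : ℂ := z * q with hAdef
  set B : ℂ := z * q ^ 2 / (1 - q) with hBdef
  have hA : ‖A‖ = r * t := norm_mul _ _
  have hB : ‖B‖ ≤ 2 * r * t ^ 2 := by
    rw [hBdef, norm_div, norm_mul, norm_pow, div_le_iff₀ (by linarith), ← hr, ← ht]
    nlinarith [mul_nonneg hr0 (sq_nonneg t)]
  -- the algebraic identity
  have key : (1 + z * (q / (1 - q))) * exp (z * log (1 - q)) - 1 =
      z * ℓ + B + ε + (A + B) * (w + ε) := by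
    have hexp : exp (z * log (1 - q)) = 1 + w + ε := by rw [hεdef, hwdef]; ring
    rw [hexp, hwdef, hlog, hBdef, hAdef, hεdef, hwdef, hlog]
    field_simp
    ring
  rw [key]
  have hAB : ‖A + B‖ ≤ 2 * r * t := by
    calc ‖A + B‖ ≤ ‖A‖ + ‖B‖ := norm_add_le _ _
      _ ≤ r * t + 2 * r * t ^ 2 := by rw [hA]; linarith
      _ ≤ 2 * r * t := by nlinarith
  have hwε : ‖w + ε‖ ≤ 3 * r * t := by
    calc ‖w + ε‖ ≤ ‖w‖ + ‖ε‖ := norm_add_le _ _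
      _ ≤ 2 * r * t + 4 * r ^ 2 * t ^ 2 := by linarith
      _ ≤ 3 * r * t := by nlinarith
  calc ‖z * ℓ + B + ε + (A + B) * (w + ε)‖
      ≤ ‖z * ℓ‖ + ‖B‖ + ‖ε‖ + ‖(A + B) * (w + ε)‖ := norm_add₄_le
    _ = r * ‖ℓ‖ + ‖B‖ + ‖ε‖ + ‖A + B‖ * ‖w + ε‖ := by rw [norm_mul, norm_mul]
    _ ≤ r * t ^ 2 + 2 * r * t ^ 2 + 4 * r ^ 2 * t ^ 2 + (2 * r * t) * (3 * r * t) := by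
        gcongr
    _ = (3 * r + 10 * r ^ 2) * t ^ 2 := by ring
    _ ≤ 10 * (r + r ^ 2) * t ^ 2 := by gcongr; nlinarith

/-- The primes tend to infinity along the cofinite filter of `Nat.Primes`. [folklore] -/
theorem tendsto_primes_val_atTop : Tendsto (fun p : Nat.Primes ↦ (p : ℕ)) cofinite atTop := by
  rw [← Nat.cofinite_eq_atTop]
  exact Nat.Primes.coe_nat_injective.tendsto_cofinite

/-- `p^{-σ} → 0` over the primes (`σ > 0`). [folklore] -/
theorem tendsto_primes_rpow_neg {σ : ℝ} (hσ : 0 < σ) :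
    Tendsto (fun p : Nat.Primes ↦ ((p : ℕ) : ℝ) ^ (-σ)) cofinite (𝓝 0) :=
  (tendsto_rpow_neg_atTop hσ).comp (tendsto_natCast_atTop_atTop.comp tendsto_primes_val_atTop)

/-- `‖p^{-s}‖ = p^{-σ}`. [folklore] -/
theorem norm_primes_cpow_neg (p : Nat.Primes) (s : ℂ) :
    ‖(p : ℂ) ^ (-s)‖ = ((p : ℕ) : ℝ) ^ (-s.re) := by
  rw [norm_natCast_cpow_of_pos p.prop.pos, neg_re]

/-- The bound on `‖E_p(s, z) - 1‖` at a prime with `p^{-σ} ≤ 1/2` and `‖z‖ p^{-σ} ≤ 1/4`: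
`‖E_p(s, z) - 1‖ ≤ 10 (‖z‖ + ‖z‖²) p^{-2σ}`. [cite: MontgomeryVaughan2007, §7.4.1 Exercise 3(a)] -/
theorem norm_eulerFactor_sub_one_le {p : Nat.Primes} {s z : ℂ}
    (hq : ((p : ℕ) : ℝ) ^ (-s.re) ≤ 1 / 2) (hzq : ‖z‖ * ((p : ℕ) : ℝ) ^ (-s.re) ≤ 1 / 4) :
    ‖eulerFactor p s z - 1‖ ≤ 10 * (‖z‖ + ‖z‖ ^ 2) * ((p : ℕ) : ℝ) ^ (-(2 * s.re)) := by
  have h := norm_factor_sub_one_le (q := (p : ℂ) ^ (-s)) (z := z)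
    (by rwa [norm_primes_cpow_neg]) (by rwa [norm_primes_cpow_neg])
  rw [norm_primes_cpow_neg] at h
  have hp0 : (0 : ℝ) ≤ ((p : ℕ) : ℝ) := Nat.cast_nonneg _
  rw [← Real.rpow_mul_natCast hp0] at h
  have e : -(2 * s.re) = -s.re * (2 : ℕ) := by push_cast; ring
  unfold eulerFactor
  rw [e]
  exact h

/-- **`∑_p ‖E_p(s, z) - 1‖ < ∞` for `σ > 1/2`** (MV Exercise 7.4.1.3 (a): the product `F(s, z)`
converges absolutely for `σ > 1/2`). [cite: MontgomeryVaughan2007, §7.4.1 Exercise 3(a)] -/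
theorem summable_norm_eulerFactor_sub_one (z : ℂ) {s : ℂ} (hs : 1 / 2 < s.re) :
    Summable fun p : Nat.Primes ↦ ‖eulerFactor p s z - 1‖ := by
  have hσ : 0 < s.re := by linarith
  have hg : Summable fun p : Nat.Primes ↦
      10 * (‖z‖ + ‖z‖ ^ 2) * ((p : ℕ) : ℝ) ^ (-(2 * s.re)) :=
    ((Nat.Primes.summable_rpow (r := -(2 * s.re))).2 (by linarith)).mul_left _
  refine hg.of_norm_bounded_eventually ?_
  have hδ : 0 < min (1 / 2 : ℝ) (1 / (4 * (‖z‖ + 1))) := lt_min (by norm_num) (by positivity)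
  filter_upwards [(tendsto_primes_rpow_neg hσ).eventually (Iio_mem_nhds hδ)] with p hp
  simp only [lt_min_iff] at hp
  rw [norm_norm]
  refine norm_eulerFactor_sub_one_le hp.1.le ?_
  have h0 : 0 ≤ ((p : ℕ) : ℝ) ^ (-s.re) := Real.rpow_nonneg (Nat.cast_nonneg _) _
  calc ‖z‖ * ((p : ℕ) : ℝ) ^ (-s.re) ≤ ‖z‖ * (1 / (4 * (‖z‖ + 1))) := by
        gcongr; exact hp.2.le
    _ ≤ 1 / 4 := by
        rw [mul_one_div, div_le_div_iff₀ (by positivity) (by norm_num)]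
        nlinarith [norm_nonneg z]

/-- `F(s, z) = ∏_p E_p(s, z)` converges (`σ > 1/2`). [cite: MontgomeryVaughan2007, §7.4.1 Exercise 3(a)] -/
theorem multipliable_eulerFactor (z : ℂ) {s : ℂ} (hs : 1 / 2 < s.re) :
    Multipliable fun p : Nat.Primes ↦ eulerFactor p s z := by
  have h := multipliable_one_add_of_summable (summable_norm_eulerFactor_sub_one z hs)
  simpa only [add_sub_cancel] using h

/-- `HasProd` form of the definition of `F(s, z)`. [folklore] -/
theorem hasProd_selbergF (z : ℂ) {s : ℂ} (hs : 1 / 2 < s.re) :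
    HasProd (fun p : Nat.Primes ↦ eulerFactor p s z) (selbergF s z) :=
  (multipliable_eulerFactor z hs).hasProd

/-- The Euler logarithm `∑_p -Log(1 - p^{-s})` of `ζ(s)` converges absolutely for `σ > 1`
(Mathlib). [folklore] -/
theorem hasSum_eulerLogZeta {s : ℂ} (hs : 1 < s.re) :
    HasSum (fun p : Nat.Primes ↦ -log (1 - (p : ℂ) ^ (-s))) (eulerLogZeta s) := by
  have h := DirichletCharacter.summable_neg_log_one_sub_mul_prime_cpow
    (1 : DirichletCharacter ℂ 1) hs
  simp only [MulChar.one_apply (isUnit_of_subsingleton _), one_mul] at h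
  exact h.hasSum

/-- **`∑ z^{ω(n)} n^{-s} = F(s, z) · exp(z ∑_p -Log(1 - p^{-s}))` for `σ > 1`**, i.e.
`a_z(n) = z^{ω(n)}` are the coefficients of `F(s, z) ζ(s)^z`.
[cite: MontgomeryVaughan2007, §7.4.1 Exercise 3(b)] -/
theorem LSeries_omegaCoeff_eq (z : ℂ) {s : ℂ} (hs : 1 < s.re) :
    LSeries (omegaCoeff z) s = selbergF s z * exp (z * eulerLogZeta s) := by
  have hF := hasProd_selbergF z (by linarith : 1 / 2 < s.re)
  have hL : HasProd (fun p : Nat.Primes ↦ exp (z * -log (1 - (p : ℂ) ^ (-s))))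
      (exp (z * eulerLogZeta s)) := ((hasSum_eulerLogZeta hs).mul_left z).cexp
  have hprod := hF.mul hL
  have heq : (fun p : Nat.Primes ↦ eulerFactor p s z * exp (z * -log (1 - (p : ℂ) ^ (-s)))) =
      fun p : Nat.Primes ↦ 1 + z * ((p : ℂ) ^ (-s) / (1 - (p : ℂ) ^ (-s))) := by
    funext p
    rw [eulerFactor, mul_assoc, ← exp_add, mul_neg, add_neg_cancel, exp_zero, mul_one]
  rw [heq] at hprod
  exact (hasProd_LSeries_omegaCoeff z hs).unique hprod


/-! ### Holomorphy of `F(s, z)` in `s` -/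

/-- `1 - p^{-s}` lies in the slit plane for `σ > 0`. [folklore] -/
theorem one_sub_prime_cpow_mem_slitPlane (p : Nat.Primes) {s : ℂ} (hs : 0 < s.re) :
    1 - (p : ℂ) ^ (-s) ∈ slitPlane := by
  left
  have h1 : ((p : ℂ) ^ (-s)).re ≤ ‖(p : ℂ) ^ (-s)‖ := re_le_norm _
  have h2 : ‖(p : ℂ) ^ (-s)‖ < 1 := by
    rw [norm_primes_cpow_neg]; exact prime_rpow_neg_lt_one p.prop hs
  simp only [sub_re, one_re]
  linarith

/-- Each factor `E_p(·, z)` is holomorphic on `σ > 0`. [folklore] -/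
theorem differentiableAt_eulerFactor (p : Nat.Primes) (z : ℂ) {s : ℂ} (hs : 0 < s.re) :
    DifferentiableAt ℂ (fun s ↦ eulerFactor p s z) s := by
  unfold eulerFactor
  have hq : DifferentiableAt ℂ (fun w : ℂ ↦ (p : ℂ) ^ (-w)) s :=
    differentiableAt_id.neg.const_cpow (Or.inl (by exact_mod_cast p.prop.ne_zero))
  have h1q : DifferentiableAt ℂ (fun w : ℂ ↦ 1 - (p : ℂ) ^ (-w)) s :=
    (differentiableAt_const _).sub hq
  have hne : (1 : ℂ) - (p : ℂ) ^ (-s) ≠ 0 :=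
    slitPlane_ne_zero (one_sub_prime_cpow_mem_slitPlane p hs)
  have hlog : DifferentiableAt ℂ (fun w : ℂ ↦ log (1 - (p : ℂ) ^ (-w))) s :=
    h1q.clog (one_sub_prime_cpow_mem_slitPlane p hs)
  exact ((differentiableAt_const _).add ((differentiableAt_const _).mul (hq.div h1q hne))).mul
    ((differentiableAt_const _).mul hlog).cexp

/-- A uniform version of the quadratic bound: for `σ ≥ σ₀ > 0`, `‖z‖ ≤ R`, and a prime with
`p^{-σ₀} ≤ 1/2`, `R p^{-σ₀} ≤ 1/4`: `‖E_p(s, z) - 1‖ ≤ 10 (R + R²) p^{-2σ₀}`. [folklore] -/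
theorem norm_eulerFactor_sub_one_le_of_le {p : Nat.Primes} {s z : ℂ} {σ₀ R : ℝ}
    (hs : σ₀ ≤ s.re) (hz : ‖z‖ ≤ R) (hq : ((p : ℕ) : ℝ) ^ (-σ₀) ≤ 1 / 2)
    (hRq : R * ((p : ℕ) : ℝ) ^ (-σ₀) ≤ 1 / 4) :
    ‖eulerFactor p s z - 1‖ ≤ 10 * (R + R ^ 2) * ((p : ℕ) : ℝ) ^ (-(2 * σ₀)) := by
  have hp1 : (1 : ℝ) ≤ ((p : ℕ) : ℝ) := by exact_mod_cast p.prop.one_lt.le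
  have hmono : ((p : ℕ) : ℝ) ^ (-s.re) ≤ ((p : ℕ) : ℝ) ^ (-σ₀) :=
    Real.rpow_le_rpow_of_exponent_le hp1 (by linarith)
  have hmono2 : ((p : ℕ) : ℝ) ^ (-(2 * s.re)) ≤ ((p : ℕ) : ℝ) ^ (-(2 * σ₀)) :=
    Real.rpow_le_rpow_of_exponent_le hp1 (by linarith)
  have h0 : 0 ≤ ((p : ℕ) : ℝ) ^ (-s.re) := Real.rpow_nonneg (Nat.cast_nonneg _) _
  have h0' : 0 ≤ ((p : ℕ) : ℝ) ^ (-σ₀) := Real.rpow_nonneg (Nat.cast_nonneg _) _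
  have hR : 0 ≤ R := (norm_nonneg z).trans hz
  have h1 : ((p : ℕ) : ℝ) ^ (-s.re) ≤ 1 / 2 := hmono.trans hq
  have h2 : ‖z‖ * ((p : ℕ) : ℝ) ^ (-s.re) ≤ 1 / 4 :=
    (mul_le_mul hz hmono h0 hR).trans hRq
  calc ‖eulerFactor p s z - 1‖ ≤ 10 * (‖z‖ + ‖z‖ ^ 2) * ((p : ℕ) : ℝ) ^ (-(2 * s.re)) :=
        norm_eulerFactor_sub_one_le h1 h2
    _ ≤ 10 * (R + R ^ 2) * ((p : ℕ) : ℝ) ^ (-(2 * σ₀)) := by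
        gcongr

/-- Eventually (in `p`) the quadratic bound holds uniformly for `σ ≥ σ₀`, `‖z‖ ≤ R`. [folklore] -/
theorem eventually_norm_eulerFactor_sub_one_le {σ₀ : ℝ} (hσ₀ : 0 < σ₀) (R : ℝ) :
    ∀ᶠ p : Nat.Primes in cofinite, ∀ s z : ℂ, σ₀ ≤ s.re → ‖z‖ ≤ R →
      ‖eulerFactor p s z - 1‖ ≤ 10 * (R + R ^ 2) * ((p : ℕ) : ℝ) ^ (-(2 * σ₀)) := by
  have hδ : 0 < min (1 / 2 : ℝ) (1 / (4 * (|R| + 1))) := lt_min (by norm_num) (by positivity)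
  filter_upwards [(tendsto_primes_rpow_neg hσ₀).eventually (Iio_mem_nhds hδ)] with p hp s z hs hz
  simp only [lt_min_iff] at hp
  refine norm_eulerFactor_sub_one_le_of_le hs hz hp.1.le ?_
  have h0 : 0 ≤ ((p : ℕ) : ℝ) ^ (-σ₀) := Real.rpow_nonneg (Nat.cast_nonneg _) _
  calc R * ((p : ℕ) : ℝ) ^ (-σ₀) ≤ |R| * (1 / (4 * (|R| + 1))) :=
        mul_le_mul (le_abs_self R) hp.2.le h0 (abs_nonneg R)
    _ ≤ 1 / 4 := by
        rw [mul_one_div, div_le_div_iff₀ (by positivity) (by norm_num)]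
        nlinarith [abs_nonneg R]

/-- **Locally uniform convergence of `F(s, z) = ∏_p E_p(s, z)` in `s` on `σ > σ₀ > 1/2`.**
[cite: MontgomeryVaughan2007, §7.4.1 Exercise 3(a)] -/
theorem hasProdLocallyUniformlyOn_eulerFactor (z : ℂ) {σ₀ : ℝ} (hσ₀ : 1 / 2 < σ₀) :
    HasProdLocallyUniformlyOn (fun (p : Nat.Primes) (s : ℂ) ↦ eulerFactor p s z)
      (fun s ↦ selbergF s z) {s : ℂ | σ₀ < s.re} := by
  have hK : IsOpen {s : ℂ | σ₀ < s.re} := isOpen_lt continuous_const continuous_re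
  have hu : Summable fun p : Nat.Primes ↦ 10 * (‖z‖ + ‖z‖ ^ 2) * ((p : ℕ) : ℝ) ^ (-(2 * σ₀)) :=
    ((Nat.Primes.summable_rpow (r := -(2 * σ₀))).2 (by linarith)).mul_left _
  have hev : ∀ᶠ p : Nat.Primes in cofinite, ∀ s ∈ {s : ℂ | σ₀ < s.re},
      ‖eulerFactor p s z - 1‖ ≤ 10 * (‖z‖ + ‖z‖ ^ 2) * ((p : ℕ) : ℝ) ^ (-(2 * σ₀)) := by
    filter_upwards [eventually_norm_eulerFactor_sub_one_le (by linarith : 0 < σ₀) ‖z‖]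
      with p hp s hs
    exact hp s z (le_of_lt hs) le_rfl
  have hcts : ∀ p : Nat.Primes, ContinuousOn (fun s ↦ eulerFactor p s z - 1) {s : ℂ | σ₀ < s.re} :=
    fun p s hs ↦ ((differentiableAt_eulerFactor p z
      (by simp only [Set.mem_setOf_eq] at hs; linarith)).continuousAt.sub
        continuousAt_const).continuousWithinAt
  have h := Summable.hasProdLocallyUniformlyOn_one_add hK hu hev hcts
  simp only [add_sub_cancel] at h
  exact h

/-- **`F(·, z)` is holomorphic on `σ > 1/2`.** [cite: MontgomeryVaughan2007, §7.4.1 Exercise 3(a)] -/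
theorem differentiableOn_selbergF (z : ℂ) :
    DifferentiableOn ℂ (fun s ↦ selbergF s z) {s : ℂ | 1 / 2 < s.re} := by
  intro s hs
  obtain ⟨σ₀, h1, h2⟩ := exists_between (show (1 : ℝ) / 2 < s.re from hs)
  have hK : IsOpen {s : ℂ | σ₀ < s.re} := isOpen_lt continuous_const continuous_re
  have hdiff : ∀ᶠ S : Finset Nat.Primes in atTop,
      DifferentiableOn ℂ (fun s ↦ ∏ p ∈ S, eulerFactor p s z) {s : ℂ | σ₀ < s.re} := by
    refine Eventually.of_forall fun S ↦ ?_
    have e : (fun s ↦ ∏ p ∈ S, eulerFactor p s z) = ∏ p ∈ S, fun s ↦ eulerFactor p s z :=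
      (Finset.prod_fn S fun p s ↦ eulerFactor p s z).symm
    rw [e]
    refine DifferentiableOn.finsetProd fun p _ w hw ↦ ?_
    exact (differentiableAt_eulerFactor p z (by
      simp only [Set.mem_setOf_eq] at hw; linarith)).differentiableWithinAt
  have h := TendstoLocallyUniformlyOn.differentiableOn
    (hasProdLocallyUniformlyOn_eulerFactor z h1) hdiff hK
  exact (h.differentiableAt (hK.mem_nhds h2)).differentiableWithinAt

/-! ### Uniform bounds for `F(s, z)` on `σ ≥ σ₀ > 1/2`, `‖z‖ ≤ R` -/

/-- A crude bound for every factor: for `σ ≥ 1/2` and `‖z‖ ≤ R`,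
`‖E_p(s, z)‖ ≤ (1 + 3R) exp(2R)`. [folklore] -/
theorem norm_eulerFactor_le {p : Nat.Primes} {s z : ℂ} {R : ℝ} (hs : 1 / 2 ≤ s.re)
    (hz : ‖z‖ ≤ R) : ‖eulerFactor p s z‖ ≤ (1 + 3 * R) * Real.exp (2 * R) := by
  set q : ℂ := (p : ℂ) ^ (-s) with hqdef
  set t : ℝ := ‖q‖ with htdef
  have hR : 0 ≤ R := (norm_nonneg z).trans hz
  have ht0 : 0 ≤ t := norm_nonneg _
  have hp2 : (2 : ℝ) ≤ ((p : ℕ) : ℝ) := by exact_mod_cast p.prop.two_le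
  have ht : t ≤ 3 / 4 := by
    calc t = ((p : ℕ) : ℝ) ^ (-s.re) := by rw [htdef, hqdef, norm_primes_cpow_neg]
      _ ≤ (2 : ℝ) ^ (-s.re) := Real.rpow_le_rpow_of_nonpos (by norm_num) hp2 (by linarith)
      _ ≤ (2 : ℝ) ^ (-(1 / 2 : ℝ)) := Real.rpow_le_rpow_of_exponent_le (by norm_num) (by linarith)
      _ ≤ 3 / 4 := PartialEuler.two_rpow_neg_half_le
  have hnq : ‖-q‖ < 1 := by rw [norm_neg]; linarith
  have h1qn : 1 - t ≤ ‖1 - q‖ := by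
    have := norm_sub_norm_le (1 : ℂ) q
    rw [norm_one] at this
    linarith
  -- the rational factor
  have hA : ‖1 + z * (q / (1 - q))‖ ≤ 1 + 3 * R := by
    have hqq : ‖q / (1 - q)‖ ≤ 3 := by
      rw [norm_div, div_le_iff₀ (by linarith)]
      linarith
    calc ‖1 + z * (q / (1 - q))‖ ≤ ‖(1 : ℂ)‖ + ‖z * (q / (1 - q))‖ := norm_add_le _ _
      _ = 1 + ‖z‖ * ‖q / (1 - q)‖ := by rw [norm_one, norm_mul]
      _ ≤ 1 + R * 3 := by gcongr
      _ = 1 + 3 * R := by ring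
  -- the exponential factor
  have hlog : ‖log (1 - q)‖ ≤ 2 := by
    have h := norm_log_one_add_le hnq
    rw [norm_neg, ← sub_eq_add_neg] at h
    have h2 : (1 - t)⁻¹ ≤ 4 := by
      rw [inv_le_comm₀ (by linarith) (by norm_num)]; linarith
    have h3 : 0 ≤ (1 - t)⁻¹ := inv_nonneg.2 (by linarith)
    calc ‖log (1 - q)‖ ≤ t ^ 2 * (1 - t)⁻¹ / 2 + t := h
      _ ≤ (3 / 4) ^ 2 * 4 / 2 + 3 / 4 := by gcongr
      _ ≤ 2 := by norm_num
  have hB : ‖exp (z * log (1 - q))‖ ≤ Real.exp (2 * R) := by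
    calc ‖exp (z * log (1 - q))‖ ≤ Real.exp ‖z * log (1 - q)‖ := norm_exp_le_exp_norm _
      _ ≤ Real.exp (2 * R) := by
          rw [Real.exp_le_exp, norm_mul]
          calc ‖z‖ * ‖log (1 - q)‖ ≤ R * 2 := mul_le_mul hz hlog (norm_nonneg _) hR
            _ = 2 * R := by ring
  calc ‖eulerFactor p s z‖ = ‖1 + z * (q / (1 - q))‖ * ‖exp (z * log (1 - q))‖ := by
        rw [eulerFactor, norm_mul]
    _ ≤ (1 + 3 * R) * Real.exp (2 * R) :=
        mul_le_mul hA hB (norm_nonneg _) (by positivity)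

/-- **Uniform boundedness of `F(s, z)`**: for every `σ₀ > 1/2` and `R` there is `B` with
`‖F(s, z)‖ ≤ B` whenever `σ ≥ σ₀` and `‖z‖ ≤ R` (the absolutely convergent product is bounded by
`∏_{p ∈ E} (1+3R)e^{2R} · exp(10(R+R²)∑_p p^{-2σ₀})`, `E` the finitely many exceptional primes).
[cite: MontgomeryVaughan2007, §7.4.1 Exercise 3(a)] -/
theorem exists_bound_selbergF {σ₀ : ℝ} (hσ₀ : 1 / 2 < σ₀) (R : ℝ) :
    ∃ B : ℝ, 0 < B ∧ ∀ s z : ℂ, σ₀ ≤ s.re → ‖z‖ ≤ R → ‖selbergF s z‖ ≤ B := by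
  classical
  set u : Nat.Primes → ℝ := fun p ↦ 10 * (R + R ^ 2) * ((p : ℕ) : ℝ) ^ (-(2 * σ₀)) with hu
  have hev := eventually_norm_eulerFactor_sub_one_le (by linarith : 0 < σ₀) R
  rw [Filter.eventually_cofinite] at hev
  set E : Finset Nat.Primes := hev.toFinset with hE
  set M₀ : ℝ := (1 + 3 * |R|) * Real.exp (2 * |R|) with hM₀
  have hM₀1 : 1 ≤ M₀ := by
    have h1 : 1 ≤ 1 + 3 * |R| := by linarith [abs_nonneg R]
    have h2 : 1 ≤ Real.exp (2 * |R|) := Real.one_le_exp (by positivity)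
    nlinarith
  have hRR : 0 ≤ R + R ^ 2 ∨ R + R ^ 2 < 0 := le_or_gt 0 _
  -- the summable majorant (made non-negative)
  set u' : Nat.Primes → ℝ := fun p ↦ |10 * (R + R ^ 2)| * ((p : ℕ) : ℝ) ^ (-(2 * σ₀)) with hu'
  have hu's : Summable u' :=
    ((Nat.Primes.summable_rpow (r := -(2 * σ₀))).2 (by linarith)).mul_left _
  have hu'0 : ∀ p, 0 ≤ u' p := fun p ↦
    mul_nonneg (abs_nonneg _) (Real.rpow_nonneg (Nat.cast_nonneg _) _)
  have huu' : ∀ p, u p ≤ u' p := fun p ↦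
    mul_le_mul_of_nonneg_right (le_abs_self _) (Real.rpow_nonneg (Nat.cast_nonneg _) _)
  set B : ℝ := M₀ ^ E.card * Real.exp (∑' p, u' p) with hB
  refine ⟨B, by positivity, fun s z hs hz ↦ ?_⟩
  have hs' : 1 / 2 < s.re := by linarith
  have hprod := (hasProd_selbergF z hs').norm
  refine hasProd_le_of_prod_le hprod fun S ↦ ?_
  -- split `S` into exceptional and good primes
  rw [← Finset.prod_filter_mul_prod_filter_not S (fun p ↦ p ∈ E)]
  have hzR : ‖z‖ ≤ |R| := hz.trans (le_abs_self R)
  have h1 : ∏ p ∈ S.filter (fun p ↦ p ∈ E), ‖eulerFactor p s z‖ ≤ M₀ ^ E.card := by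
    calc ∏ p ∈ S.filter (fun p ↦ p ∈ E), ‖eulerFactor p s z‖
        ≤ ∏ p ∈ S.filter (fun p ↦ p ∈ E), M₀ :=
          Finset.prod_le_prod (fun p _ ↦ norm_nonneg _)
            fun p _ ↦ norm_eulerFactor_le (by linarith) hzR
      _ = M₀ ^ (S.filter (fun p ↦ p ∈ E)).card := Finset.prod_const _
      _ ≤ M₀ ^ E.card := by
          refine pow_le_pow_right₀ hM₀1 (Finset.card_le_card fun p hp ↦ ?_)
          exact (Finset.mem_filter.1 hp).2
  have h2 : ∏ p ∈ S.filter (fun p ↦ ¬ p ∈ E), ‖eulerFactor p s z‖ ≤ Real.exp (∑' p, u' p) := by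
    have hgood : ∀ p ∈ S.filter (fun p ↦ ¬ p ∈ E), ‖eulerFactor p s z‖ ≤ 1 + u' p := by
      intro p hp
      have hpE : p ∉ E := (Finset.mem_filter.1 hp).2
      have hpE' : ¬ ¬ (∀ s z : ℂ, σ₀ ≤ s.re → ‖z‖ ≤ R →
          ‖eulerFactor p s z - 1‖ ≤ 10 * (R + R ^ 2) * ((p : ℕ) : ℝ) ^ (-(2 * σ₀))) := by
        rwa [hE, Set.Finite.mem_toFinset] at hpE
      push Not at hpE'
      have hb := (hpE' s z hs hz).trans (huu' p)
      calc ‖eulerFactor p s z‖ = ‖1 + (eulerFactor p s z - 1)‖ := by rw [add_sub_cancel]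
        _ ≤ ‖(1 : ℂ)‖ + ‖eulerFactor p s z - 1‖ := norm_add_le _ _
        _ ≤ 1 + u' p := by rw [norm_one]; linarith
    calc ∏ p ∈ S.filter (fun p ↦ ¬ p ∈ E), ‖eulerFactor p s z‖
        ≤ ∏ p ∈ S.filter (fun p ↦ ¬ p ∈ E), (1 + u' p) :=
          Finset.prod_le_prod (fun p _ ↦ norm_nonneg _) hgood
      _ ≤ ∏ p ∈ S.filter (fun p ↦ ¬ p ∈ E), Real.exp (u' p) :=
          Finset.prod_le_prod (fun p _ ↦ by linarith [hu'0 p]) fun p _ ↦ by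
            linarith [Real.add_one_le_exp (u' p)]
      _ = Real.exp (∑ p ∈ S.filter (fun p ↦ ¬ p ∈ E), u' p) := (Real.exp_sum _ _).symm
      _ ≤ Real.exp (∑' p, u' p) := by
          rw [Real.exp_le_exp]
          exact sum_le_hasSum _ (fun p _ ↦ hu'0 p) hu's.hasSum
  calc (∏ p ∈ S.filter (fun p ↦ p ∈ E), ‖eulerFactor p s z‖) *
        ∏ p ∈ S.filter (fun p ↦ ¬ p ∈ E), ‖eulerFactor p s z‖
      ≤ M₀ ^ E.card * Real.exp (∑' p, u' p) :=
        mul_le_mul h1 h2 (Finset.prod_nonneg fun p _ ↦ norm_nonneg _) (by positivity)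
    _ = B := rfl

end SatheSelberg

end Literature.NumberTheory.LFunctions
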